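import Summits.CriticalPhenomena.PercolationContinuityZ3.Theorems.PercNearOneGluingNoHeavyLowerTailSahiCombTriWShell

/-!
# `TRI_W(a)` on cylinder cells: the PARTIAL-REFLECTION normal form and the block-flip-closed stratum (every `a`, every cell)

Support file of the one-cut programme (crux `NoHeavyLowerTail`, stmt-CriticalPhenomena-4575; lemma factory `prim-lf-1` gen 29; memo
`FROM-prim-lf-1-gen29-RHO-INTERPOLATION.md` §2).  Companion of `…SahiCombTriWShell` (P5's Kleitman–shell normal form `triW_eq_shell`).

On a CELL of the triangle class the cube `W = Finset γ` is a product `2^S × 2^{Sᶜ}` for a block of coordinates `S ⊆ γ`, the first family `F` consists of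
`S`-cylinders (membership of `e` depends only on `e ∩ S`) and the second family `G` of `Sᶜ`-cylinders.  Besides the full antipode
`e ↦ eᶜ` the cube then carries the two PARTIAL reflections `e ↦ e ∆ S` (flip the `S`-block) and `e ↦ e ∆ Sᶜ`, and the one-cube triangle functional
`FiveUpSet.triW P F G` (the (M⁺⁺-3) coefficient of the cell, `…SahiCombTriWGeneral`) admits a second normal form in which the index `x` is paired with
ITSELF (not with `xᶜ`) and the shell weight `c = shellWeight F G` (`≥ 0` pointwise, `…TriWShell`) is read on the two partial reflections of `P`:

  `triW P F G = D(P,F,G) + Σ_{e ∈ P ∆ S} c(e) + Σ_{e ∈ P ∆ Sᶜ} c(e) − Σ_{e ∈ refl P} c(e)`        (`triW_eq_partialRefl`)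

where `P ∆ S := {e ∆ S | e ∈ P}` and `D(P,F,G) = Σ_x [(#(P ∩ F x ∩ G x) − #(P ∩ F x ∩ refl (G x))) + (#(P ∩ G x ∩ F x) − #(P ∩ G x ∩ refl (F x)))]`
is a sum of `2·2^a` UNTILTED Kleitman gaps, each `≥ 0` for up-sets (`diagPart_nonneg`).  Pointwise the weight of `c(e)` is
`[e ∆ S ∈ P] + [e ∆ Sᶜ ∈ P] − [eᶜ ∈ P] ∈ {−1,0,1,2}`: on a cell the compensation of the only negative term `−c(refl P)` of the Kleitman–shell form is
LOCAL in the four-point orbit `{e, e ∆ S, e ∆ Sᶜ, eᶜ}` (memo §2: in the symmetric three-cube language `TRI = Σ_{h} Kl_X + Σ_{g} Kl_Y + Σ ω_f·Kl_Z`).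
Consequences (unconditional, every index cube `Finset β`, every cell):
* **`triW_nonneg_of_flipClosed`** — if the up-set `P` is closed under at least one block flip at each of its points
  (`∀ e ∈ P, e ∆ S ∈ P ∨ e ∆ Sᶜ ∈ P`), then `0 ≤ triW P F G` for all monotone families of up-sets `F` (`S`-cylinders), `G` (`Sᶜ`-cylinders);
* **`triW_nonneg_of_union_cylinder`** — in particular for `P = A ∪ B` with `A` an `S`-cylinder up-set and `B` an `Sᶜ`-cylinder up-set: in the
  dictionary of report §10.3 / `…SahiCombTriWGeneral` (`W = 2^b × 2^c`, `F x = f(x,·) × 2^c`, `G x = 2^b × g(x,·)`, `P = h`) this is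
  `TRI(a,b,c)(f,g,h) ≥ 0` on EVERY cell whenever `h(y,z) = u(y) ∨ v(z)` is the union of a `Y`-cylinder and a `Z`-cylinder (f, g arbitrary increasing),
  a stratum of `FiveUpSet.TriWIneq` on cells defined by a condition on `P` alone and not contained in the known ones (`refl P ⊆ P`, principal /
  refl-closed subface, thin edge, co-nested, cells `(c,2,2)`).
HONEST LABEL: an identity, a Kleitman estimate and an easy stratum; `TriWIneq` (a ≥ 2) and the cells with all blocks `≥ 2` and `h` a RECTANGLE
`u(y) ∧ v(z)` (where the weight is `−1` off `u × v`) remain OPEN. [this work]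
-/

namespace Summit.CriticalPhenomena.PercolationContinuityZ3.Theorems

namespace FiveUpSet

open Finset
open scoped symmDiff

variable {β γ : Type} [DecidableEq β] [Fintype β] [DecidableEq γ] [Fintype γ]

/-! ### Cylinder families and partial reflections -/

/-! Throughout, "`F` is a family of `S`-cylinders" is the hypothesis `∀ x e e', e ∩ S = e' ∩ S → (e ∈ F x ↔ e' ∈ F x)` (membership depends
only on the `S`-trace; for `W = 2^b × 2^c` and `S` = the first block these are the sets `f(x,·) × 2^c`), and `G` is a family of `Sᶜ`-cylinders. -/

/-- `(e ∆ S) ∩ S = eᶜ ∩ S`. [this work] -/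
theorem symmDiff_inter_eq_compl_inter (e S : Finset γ) : (e ∆ S) ∩ S = eᶜ ∩ S := by
  ext i; simp only [mem_inter, mem_symmDiff, mem_compl]; tauto

/-- `(e ∆ S) ∩ Sᶜ = e ∩ Sᶜ`. [this work] -/
theorem symmDiff_inter_compl_eq (e S : Finset γ) : (e ∆ S) ∩ Sᶜ = e ∩ Sᶜ := by
  ext i; simp only [mem_inter, mem_symmDiff, mem_compl]; tauto

/-- `(e ∆ Sᶜ) ∩ S = e ∩ S`. [this work] -/
theorem symmDiff_compl_inter_eq (e S : Finset γ) : (e ∆ Sᶜ) ∩ S = e ∩ S := by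
  ext i; simp only [mem_inter, mem_symmDiff, mem_compl]; tauto

/-- `(e ∆ Sᶜ) ∩ Sᶜ = eᶜ ∩ Sᶜ`. [this work] -/
theorem symmDiff_compl_inter_compl_eq (e S : Finset γ) : (e ∆ Sᶜ) ∩ Sᶜ = eᶜ ∩ Sᶜ := by
  ext i; simp only [mem_inter, mem_symmDiff, mem_compl]; tauto

/-- `eᶜ ∆ S = e ∆ Sᶜ` (the two partial reflections are exchanged by the full antipode). [this work] -/
theorem compl_symmDiff_eq (e S : Finset γ) : eᶜ ∆ S = e ∆ Sᶜ := by
  ext i; simp only [mem_symmDiff, mem_compl]; tauto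

/-- `eᶜ ∆ Sᶜ = e ∆ S`. [this work] -/
theorem compl_symmDiff_compl_eq (e S : Finset γ) : eᶜ ∆ Sᶜ = e ∆ S := by
  ext i; simp only [mem_symmDiff, mem_compl]; tauto

omit [Fintype γ] in
/-- Membership in the partially reflected family `P ∆ S = {e ∆ S | e ∈ P}`: `e ∈ P.image (· ∆ S) ↔ e ∆ S ∈ P`. [this work] -/
theorem mem_image_symmDiff {P : Finset (Finset γ)} {S e : Finset γ} : e ∈ P.image (· ∆ S) ↔ e ∆ S ∈ P := by
  constructor
  · rintro h
    obtain ⟨e', he', rfl⟩ := mem_image.1 h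
    simpa [symmDiff_symmDiff_cancel_right] using he'
  · intro h
    exact mem_image.2 ⟨e ∆ S, h, by simp [symmDiff_symmDiff_cancel_right]⟩

omit [Fintype γ] in
/-- Summing over the partially reflected family: `Σ_{e ∈ P ∆ S} u(e) = Σ_{e ∈ P} u(e ∆ S)` (the block flip is an involution). [this work] -/
theorem sum_image_symmDiff (P : Finset (Finset γ)) (S : Finset γ) (u : Finset γ → ℤ) :
    ∑ e ∈ P.image (· ∆ S), u e = ∑ e ∈ P, u (e ∆ S) := by
  refine sum_image ?_
  intro e _ e' _ h
  have := congrArg (· ∆ S) h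
  simpa [symmDiff_symmDiff_cancel_right] using this

/-! ### Index profiles under the block flips -/

omit [DecidableEq β] in
/-- For `S`-cylinders, flipping the `S`-block of `e` gives the index profile of `eᶜ`: `idxSet F (e ∆ S) = idxSet F eᶜ`. [this work] -/
theorem idxSet_symmDiff_of_cyl {S : Finset γ} {F : Finset β → Finset (Finset γ)}
    (hF : ∀ x e e', e ∩ S = e' ∩ S → (e ∈ F x ↔ e' ∈ F x)) (e : Finset γ) :
    idxSet F (e ∆ S) = idxSet F eᶜ := by
  ext x
  rw [mem_idxSet, mem_idxSet]
  exact hF x _ _ (symmDiff_inter_eq_compl_inter e S)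

omit [DecidableEq β] in
/-- For `Sᶜ`-cylinders, flipping the `S`-block does not change the index profile: `idxSet G (e ∆ S) = idxSet G e`. [this work] -/
theorem idxSet_symmDiff_of_cyl_compl {S : Finset γ} {G : Finset β → Finset (Finset γ)}
    (hG : ∀ x e e', e ∩ Sᶜ = e' ∩ Sᶜ → (e ∈ G x ↔ e' ∈ G x)) (e : Finset γ) :
    idxSet G (e ∆ S) = idxSet G e := by
  ext x
  rw [mem_idxSet, mem_idxSet]
  exact hG x _ _ (symmDiff_inter_compl_eq e S)

omit [DecidableEq β] in
/-- For `S`-cylinders, flipping the `Sᶜ`-block does not change the index profile: `idxSet F (e ∆ Sᶜ) = idxSet F e`. [this work] -/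
theorem idxSet_symmDiff_compl_of_cyl {S : Finset γ} {F : Finset β → Finset (Finset γ)}
    (hF : ∀ x e e', e ∩ S = e' ∩ S → (e ∈ F x ↔ e' ∈ F x)) (e : Finset γ) :
    idxSet F (e ∆ Sᶜ) = idxSet F e := by
  ext x
  rw [mem_idxSet, mem_idxSet]
  exact hF x _ _ (symmDiff_compl_inter_eq e S)

omit [DecidableEq β] in
/-- For `Sᶜ`-cylinders, flipping the `Sᶜ`-block of `e` gives the index profile of `eᶜ`: `idxSet G (e ∆ Sᶜ) = idxSet G eᶜ`. [this work] -/
theorem idxSet_symmDiff_compl_of_cyl_compl {S : Finset γ} {G : Finset β → Finset (Finset γ)}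
    (hG : ∀ x e e', e ∩ Sᶜ = e' ∩ Sᶜ → (e ∈ G x ↔ e' ∈ G x)) (e : Finset γ) :
    idxSet G (e ∆ Sᶜ) = idxSet G eᶜ := by
  ext x
  rw [mem_idxSet, mem_idxSet]
  exact hG x _ _ (symmDiff_compl_inter_compl_eq e S)

/-! ### Double counting with one reflected profile -/

omit [DecidableEq β] [Fintype γ] in
/-- Generic double counting: if `x ∈ T e ↔ e ∈ U x`, then `Σ_{e ∈ P} #(T e) = Σ_x #(P ∩ U x)`. [this work] -/
theorem sum_card_eq_sum_card_inter (P : Finset (Finset γ)) (T : Finset γ → Finset (Finset β)) (U : Finset β → Finset (Finset γ))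
    (h : ∀ e x, x ∈ T e ↔ e ∈ U x) :
    ∑ e ∈ P, ((T e).card : ℤ) = ∑ x : Finset β, ((P ∩ U x).card : ℤ) := by
  have h1 : ∀ e, ((T e).card : ℤ) = ∑ x : Finset β, (if e ∈ U x then (1 : ℤ) else 0) := by
    intro e
    rw [Finset.sum_boole]
    have hT : (Finset.univ.filter fun x => e ∈ U x) = T e := by
      ext x; simp [h e x]
    rw [hT]
  have h2 : ∀ x : Finset β, ((P ∩ U x).card : ℤ) = ∑ e ∈ P, (if e ∈ U x then (1 : ℤ) else 0) := by
    intro x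
    rw [Finset.sum_boole, Finset.filter_mem_eq_inter]
  simp only [h1, h2]
  exact Finset.sum_comm

/-- `Σ_{e ∈ P} c(e ∆ S) = Σ_x (#(P ∩ refl (F x) ∩ G x) − #(P ∩ refl (F x) ∩ G xᶜ))` for cylinder families. [this work] -/
theorem sum_shellWeight_symmDiff {S : Finset γ} {F G : Finset β → Finset (Finset γ)}
    (hF : ∀ x e e', e ∩ S = e' ∩ S → (e ∈ F x ↔ e' ∈ F x))
    (hG : ∀ x e e', e ∩ Sᶜ = e' ∩ Sᶜ → (e ∈ G x ↔ e' ∈ G x)) (P : Finset (Finset γ)) :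
    ∑ e ∈ P, shellWeight F G (e ∆ S)
      = ∑ x : Finset β, (((P ∩ refl (F x) ∩ G x).card : ℤ) - (P ∩ refl (F x) ∩ G xᶜ).card) := by
  have hA : ∑ e ∈ P, ((idxSet F eᶜ ∩ idxSet G e).card : ℤ) = ∑ x : Finset β, ((P ∩ (refl (F x) ∩ G x)).card : ℤ) :=
    sum_card_eq_sum_card_inter P _ _ (fun e x => by simp [mem_refl])
  have hB : ∑ e ∈ P, ((idxSet F eᶜ ∩ refl (idxSet G e)).card : ℤ) = ∑ x : Finset β, ((P ∩ (refl (F x) ∩ G xᶜ)).card : ℤ) :=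
    sum_card_eq_sum_card_inter P _ _ (fun e x => by simp [mem_refl])
  unfold shellWeight
  simp only [idxSet_symmDiff_of_cyl hF, idxSet_symmDiff_of_cyl_compl hG]
  rw [sum_sub_distrib, sum_sub_distrib, hA, hB]
  simp only [inter_assoc]

/-- `Σ_{e ∈ P} c(e ∆ Sᶜ) = Σ_x (#(P ∩ F x ∩ refl (G x)) − #(P ∩ F x ∩ refl (G xᶜ)))` for cylinder families. [this work] -/
theorem sum_shellWeight_symmDiff_compl {S : Finset γ} {F G : Finset β → Finset (Finset γ)}
    (hF : ∀ x e e', e ∩ S = e' ∩ S → (e ∈ F x ↔ e' ∈ F x))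
    (hG : ∀ x e e', e ∩ Sᶜ = e' ∩ Sᶜ → (e ∈ G x ↔ e' ∈ G x)) (P : Finset (Finset γ)) :
    ∑ e ∈ P, shellWeight F G (e ∆ Sᶜ)
      = ∑ x : Finset β, (((P ∩ F x ∩ refl (G x)).card : ℤ) - (P ∩ F x ∩ refl (G xᶜ)).card) := by
  have hA : ∑ e ∈ P, ((idxSet F e ∩ idxSet G eᶜ).card : ℤ) = ∑ x : Finset β, ((P ∩ (F x ∩ refl (G x))).card : ℤ) :=
    sum_card_eq_sum_card_inter P _ _ (fun e x => by simp [mem_refl])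
  have hB : ∑ e ∈ P, ((idxSet F e ∩ refl (idxSet G eᶜ)).card : ℤ) = ∑ x : Finset β, ((P ∩ (F x ∩ refl (G xᶜ))).card : ℤ) :=
    sum_card_eq_sum_card_inter P _ _ (fun e x => by simp [mem_refl])
  unfold shellWeight
  simp only [idxSet_symmDiff_compl_of_cyl hF, idxSet_symmDiff_compl_of_cyl_compl hG]
  rw [sum_sub_distrib, sum_sub_distrib, hA, hB]
  simp only [inter_assoc]

/-! ### The diagonal Kleitman part and the normal form -/

omit [DecidableEq β] in
/-- **The diagonal Kleitman part is non-negative**: the untilted gaps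
`Σ_x [(#(P ∩ F x ∩ G x) − #(P ∩ F x ∩ refl (G x))) + (#(P ∩ G x ∩ F x) − #(P ∩ G x ∩ refl (F x)))]` (index `x` paired with `x`, not with `xᶜ`
as in `kleitmanPart`) are `≥ 0` when `P` and all `F x`, `G x` are up-sets (Kleitman's lemma inside `P ∩ F x` and `P ∩ G x`). [this work] -/
theorem diagPart_nonneg (P : Finset (Finset γ)) (F G : Finset β → Finset (Finset γ))
    (hP : IsUpperSet (P : Set (Finset γ))) (hF : ∀ x, IsUpperSet (F x : Set (Finset γ)))
    (hG : ∀ x, IsUpperSet (G x : Set (Finset γ))) :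
    0 ≤ ∑ x : Finset β, ((((P ∩ F x ∩ G x).card : ℤ) - (P ∩ F x ∩ refl (G x)).card)
        + (((P ∩ G x ∩ F x).card : ℤ) - (P ∩ G x ∩ refl (F x)).card)) := by
  refine sum_nonneg fun x _ => ?_
  have hPF : IsUpperSet ((P ∩ F x : Finset (Finset γ)) : Set (Finset γ)) := by
    rw [coe_inter]; exact hP.inter (hF x)
  have hPG : IsUpperSet ((P ∩ G x : Finset (Finset γ)) : Set (Finset γ)) := by
    rw [coe_inter]; exact hP.inter (hG x)
  have h1 := card_inter_refl_le hPF (hG x)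
  have h2 := card_inter_refl_le hPG (hF x)
  omega

/-- **Partial-reflection normal form of `TRI_W(a)` on a cell** (every index cube; `F` `S`-cylinders, `G` `Sᶜ`-cylinders; no up-set hypothesis):
`triW P F G = D + Σ_{e ∈ P ∆ S} c(e) + Σ_{e ∈ P ∆ Sᶜ} c(e) − Σ_{e ∈ refl P} c(e)`, `c = shellWeight F G`, `D` = the diagonal Kleitman part of
`diagPart_nonneg`. [this work] -/
theorem triW_eq_partialRefl (S : Finset γ) (P : Finset (Finset γ)) (F G : Finset β → Finset (Finset γ))
    (hF : ∀ x e e', e ∩ S = e' ∩ S → (e ∈ F x ↔ e' ∈ F x))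
    (hG : ∀ x e e', e ∩ Sᶜ = e' ∩ Sᶜ → (e ∈ G x ↔ e' ∈ G x)) :
    triW P F G = ∑ x : Finset β, ((((P ∩ F x ∩ G x).card : ℤ) - (P ∩ F x ∩ refl (G x)).card)
        + (((P ∩ G x ∩ F x).card : ℤ) - (P ∩ G x ∩ refl (F x)).card))
      + ∑ e ∈ P.image (· ∆ S), shellWeight F G e + ∑ e ∈ P.image (· ∆ Sᶜ), shellWeight F G e
      - ∑ e ∈ refl P, shellWeight F G e := by
  rw [triW_eq_shell, sum_image_symmDiff, sum_image_symmDiff, sum_shellWeight_symmDiff hF hG, sum_shellWeight_symmDiff_compl hF hG,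
    sum_shellWeight_eq]
  -- the two re-indexings `x ↦ xᶜ`
  have h1 : ∑ x : Finset β, ((P ∩ G x ∩ F xᶜ).card : ℤ) = ∑ x : Finset β, ((P ∩ F x ∩ G xᶜ).card : ℤ) := by
    refine Fintype.sum_equiv (complEquiv β) _ _ (fun x => ?_)
    show ((P ∩ G x ∩ F xᶜ).card : ℤ) = ((P ∩ F xᶜ ∩ G xᶜᶜ).card : ℤ)
    rw [compl_compl, inter_assoc, inter_comm (G x), ← inter_assoc]
  have h2 : ∑ x : Finset β, ((P ∩ G x ∩ refl (F xᶜ)).card : ℤ)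
      = ∑ x : Finset β, ((P ∩ refl (F x) ∩ G xᶜ).card : ℤ) := by
    refine Fintype.sum_equiv (complEquiv β) _ _ (fun x => ?_)
    show ((P ∩ G x ∩ refl (F xᶜ)).card : ℤ) = ((P ∩ refl (F xᶜ) ∩ G xᶜᶜ).card : ℤ)
    rw [compl_compl, inter_assoc, inter_comm (G x), ← inter_assoc]
  -- per-index bookkeeping
  have hx : ∀ x : Finset β,
      ((((P ∩ F x ∩ G xᶜ).card : ℤ) - (P ∩ F x ∩ refl (G xᶜ)).card)
        + (((P ∩ G x ∩ F xᶜ).card : ℤ) - (P ∩ G x ∩ refl (F xᶜ)).card))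
      + 2 * (((P ∩ F x ∩ G x).card : ℤ) - (P ∩ F x ∩ G xᶜ).card)
      = (((((P ∩ F x ∩ G x).card : ℤ) - (P ∩ F x ∩ refl (G x)).card)
          + (((P ∩ G x ∩ F x).card : ℤ) - (P ∩ G x ∩ refl (F x)).card))
        + (((P ∩ refl (F x) ∩ G x).card : ℤ) - (P ∩ refl (F x) ∩ G xᶜ).card)
        + (((P ∩ F x ∩ refl (G x)).card : ℤ) - (P ∩ F x ∩ refl (G xᶜ)).card))
        + ((((P ∩ G x ∩ F xᶜ).card : ℤ) - (P ∩ F x ∩ G xᶜ).card)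
          - (((P ∩ G x ∩ refl (F xᶜ)).card : ℤ) - (P ∩ refl (F x) ∩ G xᶜ).card)) := by
    intro x
    have e1 : P ∩ G x ∩ F x = P ∩ F x ∩ G x := by rw [inter_assoc, inter_comm (G x), ← inter_assoc]
    have e2 : P ∩ G x ∩ refl (F x) = P ∩ refl (F x) ∩ G x := by rw [inter_assoc, inter_comm (G x), ← inter_assoc]
    rw [e1, e2]
    ring
  -- the re-indexed remainder sums to zero
  have split : ∑ x : Finset β, ((((P ∩ G x ∩ F xᶜ).card : ℤ) - (P ∩ F x ∩ G xᶜ).card)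
          - (((P ∩ G x ∩ refl (F xᶜ)).card : ℤ) - (P ∩ refl (F x) ∩ G xᶜ).card))
      = (∑ x : Finset β, ((P ∩ G x ∩ F xᶜ).card : ℤ) - ∑ x : Finset β, ((P ∩ F x ∩ G xᶜ).card : ℤ))
        - (∑ x : Finset β, ((P ∩ G x ∩ refl (F xᶜ)).card : ℤ) - ∑ x : Finset β, ((P ∩ refl (F x) ∩ G xᶜ).card : ℤ)) := by
    rw [sum_sub_distrib, sum_sub_distrib, sum_sub_distrib]
  have hzero : ∑ x : Finset β, ((((P ∩ G x ∩ F xᶜ).card : ℤ) - (P ∩ F x ∩ G xᶜ).card)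
          - (((P ∩ G x ∩ refl (F xᶜ)).card : ℤ) - (P ∩ refl (F x) ∩ G xᶜ).card)) = 0 := by
    rw [split, h1, h2]; ring
  have hL : kleitmanPart P F G + 2 * ∑ x : Finset β, (((P ∩ F x ∩ G x).card : ℤ) - (P ∩ F x ∩ G xᶜ).card)
      = ∑ x : Finset β, (((((P ∩ F x ∩ G xᶜ).card : ℤ) - (P ∩ F x ∩ refl (G xᶜ)).card)
        + (((P ∩ G x ∩ F xᶜ).card : ℤ) - (P ∩ G x ∩ refl (F xᶜ)).card))
      + 2 * (((P ∩ F x ∩ G x).card : ℤ) - (P ∩ F x ∩ G xᶜ).card)) := by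
    unfold kleitmanPart
    rw [Finset.mul_sum, ← sum_add_distrib]
  have hR : ∑ x : Finset β, ((((P ∩ F x ∩ G x).card : ℤ) - (P ∩ F x ∩ refl (G x)).card)
        + (((P ∩ G x ∩ F x).card : ℤ) - (P ∩ G x ∩ refl (F x)).card))
        + ∑ x : Finset β, (((P ∩ refl (F x) ∩ G x).card : ℤ) - (P ∩ refl (F x) ∩ G xᶜ).card)
        + ∑ x : Finset β, (((P ∩ F x ∩ refl (G x)).card : ℤ) - (P ∩ F x ∩ refl (G xᶜ)).card)
      = ∑ x : Finset β, ((((((P ∩ F x ∩ G x).card : ℤ) - (P ∩ F x ∩ refl (G x)).card)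
          + (((P ∩ G x ∩ F x).card : ℤ) - (P ∩ G x ∩ refl (F x)).card))
        + (((P ∩ refl (F x) ∩ G x).card : ℤ) - (P ∩ refl (F x) ∩ G xᶜ).card))
        + (((P ∩ F x ∩ refl (G x)).card : ℤ) - (P ∩ F x ∩ refl (G xᶜ)).card)) := by
    rw [← sum_add_distrib, ← sum_add_distrib]
  have hmid : ∑ x : Finset β, (((((P ∩ F x ∩ G xᶜ).card : ℤ) - (P ∩ F x ∩ refl (G xᶜ)).card)
        + (((P ∩ G x ∩ F xᶜ).card : ℤ) - (P ∩ G x ∩ refl (F xᶜ)).card))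
      + 2 * (((P ∩ F x ∩ G x).card : ℤ) - (P ∩ F x ∩ G xᶜ).card)) = ∑ x : Finset β, ((((((P ∩ F x ∩ G x).card : ℤ) - (P ∩ F x ∩ refl (G x)).card)
          + (((P ∩ G x ∩ F x).card : ℤ) - (P ∩ G x ∩ refl (F x)).card))
        + (((P ∩ refl (F x) ∩ G x).card : ℤ) - (P ∩ refl (F x) ∩ G xᶜ).card))
        + (((P ∩ F x ∩ refl (G x)).card : ℤ) - (P ∩ F x ∩ refl (G xᶜ)).card)) := by
    calc ∑ x : Finset β, (((((P ∩ F x ∩ G xᶜ).card : ℤ) - (P ∩ F x ∩ refl (G xᶜ)).card)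
        + (((P ∩ G x ∩ F xᶜ).card : ℤ) - (P ∩ G x ∩ refl (F xᶜ)).card))
      + 2 * (((P ∩ F x ∩ G x).card : ℤ) - (P ∩ F x ∩ G xᶜ).card))
        = ∑ x : Finset β, (((((((P ∩ F x ∩ G x).card : ℤ) - (P ∩ F x ∩ refl (G x)).card)
          + (((P ∩ G x ∩ F x).card : ℤ) - (P ∩ G x ∩ refl (F x)).card))
        + (((P ∩ refl (F x) ∩ G x).card : ℤ) - (P ∩ refl (F x) ∩ G xᶜ).card))
        + (((P ∩ F x ∩ refl (G x)).card : ℤ) - (P ∩ F x ∩ refl (G xᶜ)).card)) + ((((P ∩ G x ∩ F xᶜ).card : ℤ) - (P ∩ F x ∩ G xᶜ).card)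
          - (((P ∩ G x ∩ refl (F xᶜ)).card : ℤ) - (P ∩ refl (F x) ∩ G xᶜ).card))) := sum_congr rfl (fun x _ => hx x)
      _ = ∑ x : Finset β, ((((((P ∩ F x ∩ G x).card : ℤ) - (P ∩ F x ∩ refl (G x)).card)
          + (((P ∩ G x ∩ F x).card : ℤ) - (P ∩ G x ∩ refl (F x)).card))
        + (((P ∩ refl (F x) ∩ G x).card : ℤ) - (P ∩ refl (F x) ∩ G xᶜ).card))
        + (((P ∩ F x ∩ refl (G x)).card : ℤ) - (P ∩ F x ∩ refl (G xᶜ)).card)) + ∑ x : Finset β, ((((P ∩ G x ∩ F xᶜ).card : ℤ) - (P ∩ F x ∩ G xᶜ).card)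
          - (((P ∩ G x ∩ refl (F xᶜ)).card : ℤ) - (P ∩ refl (F x) ∩ G xᶜ).card)) := sum_add_distrib
      _ = ∑ x : Finset β, ((((((P ∩ F x ∩ G x).card : ℤ) - (P ∩ F x ∩ refl (G x)).card)
          + (((P ∩ G x ∩ F x).card : ℤ) - (P ∩ G x ∩ refl (F x)).card))
        + (((P ∩ refl (F x) ∩ G x).card : ℤ) - (P ∩ refl (F x) ∩ G xᶜ).card))
        + (((P ∩ F x ∩ refl (G x)).card : ℤ) - (P ∩ F x ∩ refl (G xᶜ)).card)) := by rw [hzero, add_zero]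
  linarith [hL, hR, hmid]

/-- Pointwise form of the weights: `e ∈ P ∆ S ↔ e ∆ S ∈ P`, `e ∈ refl P ↔ eᶜ ∈ P`; so the coefficient of `c(e)` in `triW_eq_partialRefl` is
`[e ∆ S ∈ P] + [e ∆ Sᶜ ∈ P] − [eᶜ ∈ P] ≥ −1`, negative only if `eᶜ ∈ P` while both block flips of `e` miss `P`. [this work] -/
theorem refl_subset_image_union_of_flipClosed {P : Finset (Finset γ)} {S : Finset γ}
    (hflip : ∀ e ∈ P, e ∆ S ∈ P ∨ e ∆ Sᶜ ∈ P) : refl P ⊆ P.image (· ∆ S) ∪ P.image (· ∆ Sᶜ) := by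
  intro e he
  rw [mem_refl] at he
  rw [mem_union, mem_image_symmDiff, mem_image_symmDiff]
  rcases hflip eᶜ he with h | h
  · right; rwa [compl_symmDiff_eq] at h
  · left; rwa [compl_symmDiff_compl_eq] at h

/-! ### The block-flip-closed stratum -/

/-- **`TRI_W(a) ≥ 0` on every cell for block-flip-closed `P`.**  Let `F` be a monotone family of `S`-cylinder up-sets and `G` a monotone family
of `Sᶜ`-cylinder up-sets over any index cube, and let the up-set `P` satisfy `∀ e ∈ P, e ∆ S ∈ P ∨ e ∆ Sᶜ ∈ P`.  Then `0 ≤ triW P F G`.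
Proof: in `triW_eq_partialRefl` the diagonal part is `≥ 0` (`diagPart_nonneg`), the shell weights are `≥ 0` pointwise (`shellWeight_nonneg`), and
`refl P ⊆ (P ∆ S) ∪ (P ∆ Sᶜ)`. [this work] -/
theorem triW_nonneg_of_flipClosed (S : Finset γ) (P : Finset (Finset γ)) (F G : Finset β → Finset (Finset γ))
    (hFc : ∀ x e e', e ∩ S = e' ∩ S → (e ∈ F x ↔ e' ∈ F x))
    (hGc : ∀ x e e', e ∩ Sᶜ = e' ∩ Sᶜ → (e ∈ G x ↔ e' ∈ G x))
    (hP : IsUpperSet (P : Set (Finset γ))) (hF : ∀ x, IsUpperSet (F x : Set (Finset γ)))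
    (hG : ∀ x, IsUpperSet (G x : Set (Finset γ))) (hFm : Monotone F) (hGm : Monotone G)
    (hflip : ∀ e ∈ P, e ∆ S ∈ P ∨ e ∆ Sᶜ ∈ P) : 0 ≤ triW P F G := by
  rw [triW_eq_partialRefl S P F G hFc hGc]
  have hd := diagPart_nonneg P F G hP hF hG
  have hnn : ∀ e, 0 ≤ shellWeight F G e := fun e => shellWeight_nonneg hFm hGm e
  have hsub := refl_subset_image_union_of_flipClosed (P := P) (S := S) hflip
  have hle : ∑ e ∈ refl P, shellWeight F G e ≤ ∑ e ∈ P.image (· ∆ S) ∪ P.image (· ∆ Sᶜ), shellWeight F G e :=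
    sum_le_sum_of_subset_of_nonneg hsub (fun e _ _ => hnn e)
  have hui := Finset.sum_union_inter (s₁ := P.image (· ∆ S)) (s₂ := P.image (· ∆ Sᶜ)) (f := shellWeight F G)
  have hint : 0 ≤ ∑ e ∈ P.image (· ∆ S) ∩ P.image (· ∆ Sᶜ), shellWeight F G e := sum_nonneg fun e _ => hnn e
  linarith

/-- **The union-of-two-cylinders stratum, every cell.**  For an `S`-cylinder up-set `A`, an `Sᶜ`-cylinder up-set `B`, and monotone cylinder
families of up-sets `F` (`S`-cylinders), `G` (`Sᶜ`-cylinders) over any index cube: `0 ≤ triW (A ∪ B) F G`.  In the cell dictionary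
(`P = h ⊆ 2^b × 2^c`): `TRI(a,b,c)(f,g,h) ≥ 0` for all `a, b, c` and all increasing `f, g` whenever `h(y,z) = u(y) ∨ v(z)`. [this work] -/
theorem triW_nonneg_of_union_cylinder (S : Finset γ) (A B : Finset (Finset γ)) (F G : Finset β → Finset (Finset γ))
    (hA : ∀ e e', e ∩ S = e' ∩ S → (e ∈ A ↔ e' ∈ A)) (hB : ∀ e e', e ∩ Sᶜ = e' ∩ Sᶜ → (e ∈ B ↔ e' ∈ B))
    (hAu : IsUpperSet (A : Set (Finset γ))) (hBu : IsUpperSet (B : Set (Finset γ)))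
    (hFc : ∀ x e e', e ∩ S = e' ∩ S → (e ∈ F x ↔ e' ∈ F x))
    (hGc : ∀ x e e', e ∩ Sᶜ = e' ∩ Sᶜ → (e ∈ G x ↔ e' ∈ G x))
    (hF : ∀ x, IsUpperSet (F x : Set (Finset γ))) (hG : ∀ x, IsUpperSet (G x : Set (Finset γ)))
    (hFm : Monotone F) (hGm : Monotone G) : 0 ≤ triW (A ∪ B) F G := by
  refine triW_nonneg_of_flipClosed S (A ∪ B) F G hFc hGc ?_ hF hG hFm hGm ?_
  · rw [coe_union]; exact hAu.union hBu
  · intro e he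
    rcases mem_union.1 he with h | h
    · right
      exact mem_union.2 (Or.inl ((hA (e ∆ Sᶜ) e (symmDiff_compl_inter_eq e S)).2 h))
    · left
      exact mem_union.2 (Or.inr ((hB (e ∆ S) e (symmDiff_inter_compl_eq e S)).2 h))

end FiveUpSet

end Summit.CriticalPhenomena.PercolationContinuityZ3.Theorems
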